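import Summits.BirchSwinnertonDyer.BirchSwinnertonDyer.Theorems.PrintCf2RubinValueTwoJLKDescentLocalProP
import HarnessLib

/-!
# (α3) KERNEL DESCENT VI — ROW 1 (a2) LOCAL, part 2: closed subgroups of `ker κ` are pro-prime-to-`p` modulo `I` (Stage 2), and
# the number-field instance «(hp′_v) for `H ≤ ker κ` at a place where the `ℤ_p`-extension `κ` is unramified and undecomposed»

Cell `bsd-print-cf2`, width seat `bsd-line-cf2c-w8` g7 (prover-bsd-line-cf2c-w8-g7-0), lane **(α3) KERNEL DESCENT**, planner brief
`Cruxes/MainConjClauseAtSplitTwoQuad/JLK-CARRIER-2-BRIEF-plan-g20.md` §1 ROW 1, -plan g20 2026-08-29T12:57:29Z layer (a2). Continuation of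
`Theorems/PrintCf2RubinValueTwoJLKDescentLocalProP.lean` (Stage 1: `not_dvd_card_quotient_ker`); see its module docstring for the whole argument.
For the DECIDING research child `PrintCf2RubinValueTwo.MainConjClauseAtSplitTwoQuadDA` (stmt-BirchSwinnertonDyer-24721); `--supports` it
`--as helper`, Theses-free.

## Contents
* §1 **`coprime_card_quotient_of_le_ker`** (STAGE 2 = the abstract theorem): `D` compact Hausdorff totally disconnected, `I ⊴ D` closed, `φ`
  with `I·⟨φ⟩` dense, `κ : D →* ℤ_p` continuous with `κ(I) = 1 ≠ κ φ`; then for every CLOSED `G ≤ ker κ` and every open subgroup `U` of `G`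
  containing `G ⊓ I`, `[G : U]` is prime to `p`. (Cauchy gives `x ∈ G ∖ U` with `x^p ∈ U`; `Ũ = U·I` is closed, `x ∉ Ũ`; the profinite
  neighbourhood basis gives an open subgroup `W₀` with `x ∉ Ũ W₀`; `V = ker κ ⊓ Ũ W₀` then has `p ∣ [ker κ : V]`, contradicting Stage 1.)
* §2 number fields (`GreenbergSelmer` vocabulary): `normal_inertia_subgroupOf_decomp`, `isClosed_inertia_subgroupOf_decomp`,
  `exists_dense_inertia_mul_zpowers_decomp` (a Frobenius lift `φ ∈ D_v` with `(I_v ⊓ D_v)·⟨φ⟩` dense: tree `exists_isFrobPow_holds` +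
  `dense_absInertia_mul_zpowers_of_isFrobPow` transported along `Γ_{K_v} ↠ D_v`), and **`coprime_card_quotient_decompIn_of_zpExtension`**:
  for `κ : ZpExtension K p` with (U) `inertia v ≤ κ.kerSubgroup` (unramified at `v`), (N) `∃ τ ∈ decomp v, κ τ ≠ 1` (`v` not totally split in
  `K̄^{ker κ}`), and a closed `H ≤ κ.kerSubgroup`:
  `∀ U : Subgroup (decompIn H v), IsOpen U → (inertiaIn H v).subgroupOf (decompIn H v) ≤ U → (Nat.card (decompIn H v ⧸ U)).Coprime p`
  — EXACTLY the displayed hypothesis (hp′_v) of part IV (`…JLKDescentUnramifiedStrict`, p720338: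
  `greenbergKer_eq_strictKer_of_coprime`, `unrEverywhere₂_eq_datumStrictSelmer_of_coprime`), which is thereby discharged for the
  `ℤ_p²`-tower `H = pairKer κ₁ κ₂ ≤ ker κ₂` whenever `κ₂` is unramified outside `v̄` (⇒ (U) at `v ≠ v̄`) and `v` is undecomposed in the
  `κ₂`-line ((N); DA7 frame: cf2c-w8 g4 `LinePin.exists_mem_decomp_vbar_apply_eq_of_discr` with `v ↔ v̄`). The composition IV ∘ VI is
  filed separately once both oleans exist.

THEOREMS ONLY (no `def`, no named fact, no `sorry`); no class field theory proved or assumed beyond (U), (N). presearch: NSW (7.1.8)(i),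
(7.5.3); Ribes–Zalesskii §2.1 [corpus]; de Shalit II.1.9. beyond-print theorem: no. No summit statement is proved by this seat; BSD is not
proved by any of this.

References: Neukirch–Schmidt–Wingberg (2008) (7.1.8), (7.5.3) [NeukirchSchmidtWingberg2008]; L. Ribes, P. Zalesskii, *Profinite Groups*
(2010) §2.1; E. de Shalit (1987) II.1.9 [deShalit1987].
-/

noncomputable section

set_option linter.dupNamespace false -- D-0017: single-problem summit, `…BirchSwinnertonDyer.BirchSwinnertonDyer…` repeats a namespace by design
set_option autoImplicit false

open scoped Classical Pointwise

namespace Summit.BirchSwinnertonDyer.BirchSwinnertonDyer.Theorems.PrintCf2.JLKDescent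

open Literature.NumberTheory.EllipticCurves Literature.NumberTheory.GaloisRepresentations

universe u

/-! ## §1. STAGE 2: closed subgroups of `ker κ` -/

section ProP

variable {D : Type u} [Group D] [TopologicalSpace D] [IsTopologicalGroup D] [CompactSpace D] [T2Space D]
  {p : ℕ} [hp : Fact p.Prime]


/-- **STAGE 2 = THE THEOREM: closed subgroups of `ker κ` are pro-prime-to-`p` modulo `I`.** `D` compact Hausdorff totally disconnected,
`I ⊴ D` closed, `φ ∈ D` with `I·⟨φ⟩` dense, `κ : D →* ℤ_p` continuous with `κ(I) = 1 ≠ κ φ`. Then for every CLOSED subgroup `G ≤ ker κ`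
and every open subgroup `U` of `G` containing `G ⊓ I`, the index `[G : U]` is prime to `p` — verbatim the hypothesis (hp′) of part IV's
`greenbergKer_eq_strictKer_of_coprime` for `G = H ⊓ D_v`, `I = I_v`. (Reduction to Stage 1 in the module docstring: Cauchy, `Ũ = U·I`,
an open subgroup `W₀` with `x ∉ Ũ W₀` from the profinite neighbourhood basis, `V = ker κ ⊓ Ũ W₀`.)
[cite: NeukirchSchmidtWingberg2008, (7.1.8) (i)] -/
theorem coprime_card_quotient_of_le_ker [TotallyDisconnectedSpace D] (I : Subgroup D) [I.Normal] (hI : IsClosed (I : Set D))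
    (φ : D) (hdense : Dense ((I : Set D) * (Subgroup.zpowers φ : Set D)))
    (κ : D →* Multiplicative ℤ_[p]) (hκ : Continuous κ) (hκI : I ≤ κ.ker) (hκφ : κ φ ≠ 1)
    (G : Subgroup D) (hG : IsClosed (G : Set D)) (hGκ : G ≤ κ.ker)
    (U : Subgroup G) (hU : IsOpen (U : Set G)) (hIU : I.subgroupOf G ≤ U) :
    (Nat.card (G ⧸ U)).Coprime p := by
  rw [Nat.coprime_comm, hp.out.coprime_iff_not_dvd]
  intro hdvd
  set N := κ.ker with hNdef
  have hcomm := commutator_mem_of_dense_mul_zpowers I hI φ hdense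
  haveI : CompactSpace G := isCompact_iff_compactSpace.mp hG.isCompact
  have hcommG : ∀ a b : G, a * b * a⁻¹ * b⁻¹ ∈ I.subgroupOf G := fun a b ↦ by
    rw [Subgroup.mem_subgroupOf, Subgroup.coe_mul, Subgroup.coe_mul, Subgroup.coe_mul, Subgroup.coe_inv, Subgroup.coe_inv]
    exact hcomm a b
  haveI : U.Normal := normal_of_commutator_le hcommG hIU
  haveI : DiscreteTopology (G ⧸ U) := QuotientGroup.discreteTopology hU
  haveI : Finite (G ⧸ U) := finite_of_compact_of_discrete
  -- Cauchy: `x ∈ G ∖ U` with `x ^ p ∈ U`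
  obtain ⟨t, ht⟩ := exists_prime_orderOf_dvd_card' (G := G ⧸ U) p hdvd
  obtain ⟨x, rfl⟩ := QuotientGroup.mk_surjective t
  have hxU : x ∉ U := fun hxU ↦ by
    rw [(QuotientGroup.eq_one_iff x).mpr hxU, orderOf_one] at ht
    exact hp.out.one_lt.ne' ht.symm
  have hxpU : x ^ p ∈ U := by
    rw [← QuotientGroup.eq_one_iff, QuotientGroup.mk_pow, ← ht, pow_orderOf_eq_one]
  -- `Ũ = U·I`, a closed subgroup of `D` not containing `x`
  let U' : Subgroup D := U.map G.subtype
  let Ut : Subgroup D := U' ⊔ I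
  have hU'c : IsCompact (U' : Set D) := by
    have h1 : IsCompact (U : Set G) := (Subgroup.isClosed_of_isOpen U hU).isCompact
    simpa [U', Subgroup.coe_map] using h1.image continuous_subtype_val
  have hUtset : (Ut : Set D) = (U' : Set D) * (I : Set D) := Subgroup.mul_normal U' I
  have hUtc : IsClosed (Ut : Set D) := by
    rw [hUtset, ← Set.image_mul_prod]
    exact ((hU'c.prod hI.isCompact).image continuous_mul).isClosed
  have hIUt : I ≤ Ut := le_sup_right
  haveI hUtn : Ut.Normal := normal_of_commutator_le hcomm hIUt
  have hxUt : (x : D) ∉ Ut := by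
    intro hx
    rw [← SetLike.mem_coe, hUtset] at hx
    obtain ⟨u, hu, i, hi, hux⟩ := hx
    obtain ⟨u₀, hu₀, rfl⟩ := Subgroup.mem_map.mp hu
    have hux' : ((u₀ : G) : D) * i = (x : D) := hux
    have hiG : i ∈ G := by
      have : i = ((u₀ : G) : D)⁻¹ * (x : D) := by rw [← hux', inv_mul_cancel_left]
      rw [this]
      exact G.mul_mem (G.inv_mem u₀.2) x.2
    have hiU : (⟨i, hiG⟩ : G) ∈ U := hIU (Subgroup.mem_subgroupOf.mpr hi)
    apply hxU
    have hx' : x = u₀ * ⟨i, hiG⟩ := Subtype.ext (by rw [Subgroup.coe_mul]; exact hux'.symm)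
    rw [hx']
    exact U.mul_mem hu₀ hiU
  -- an open subgroup `W₀` of `D` with `x ∉ Ũ W₀`
  have hO : IsOpen ((fun u : D ↦ u * (x : D)) '' (Ut : Set D))ᶜ :=
    ((Homeomorph.mulRight (x : D)).isClosedMap _ hUtc).isOpen_compl
  have h1O : (1 : D) ∈ ((fun u : D ↦ u * (x : D)) '' (Ut : Set D))ᶜ := by
    rintro ⟨u, hu, hu1⟩
    apply hxUt
    rw [eq_inv_of_mul_eq_one_right hu1]
    exact Ut.inv_mem hu
  obtain ⟨W, hWclopen, h1W, hWO⟩ := compact_exists_isClopen_in_isOpen hO h1O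
  obtain ⟨W₀, hW₀⟩ := IsTopologicalGroup.exist_openSubgroup_sub_clopen_nhds_of_one hWclopen h1W
  have hxUtW : (x : D) ∉ (Ut : Set D) * (W₀ : Set D) := by
    rintro ⟨u, hu, w, hw, huw⟩
    have hwO : w ∈ ((fun u : D ↦ u * (x : D)) '' (Ut : Set D))ᶜ := hWO (hW₀ hw)
    apply hwO
    refine ⟨u⁻¹, Ut.inv_mem hu, ?_⟩
    rw [← huw]
    group
  -- `V = ker κ ⊓ Ũ W₀`: between `I` and `ker κ`, closed, of finite index divisible by `p` in `ker κ`
  let V : Subgroup D := (Ut ⊔ W₀.toSubgroup) ⊓ N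
  have hsupset : ((Ut ⊔ W₀.toSubgroup : Subgroup D) : Set D) = (Ut : Set D) * (W₀ : Set D) :=
    Subgroup.normal_mul Ut W₀.toSubgroup
  have hsupo : IsOpen ((Ut ⊔ W₀.toSubgroup : Subgroup D) : Set D) := Subgroup.isOpen_mono le_sup_right W₀.isOpen
  have hNc : IsClosed (N : Set D) := by
    rw [hNdef, MonoidHom.coe_ker]
    exact isClosed_singleton.preimage hκ
  have hIV : I ≤ V := le_inf (hIUt.trans le_sup_left) hκI
  have hVN : V ≤ N := inf_le_right
  haveI : V.Normal := normal_of_commutator_le hcomm hIV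
  have hVc : IsClosed (V : Set D) := by
    change IsClosed (((Ut ⊔ W₀.toSubgroup : Subgroup D) : Set D) ∩ (N : Set D))
    exact (Subgroup.isClosed_of_isOpen _ hsupo).inter hNc
  haveI : CompactSpace N := isCompact_iff_compactSpace.mp hNc.isCompact
  have hVo : IsOpen ((V.subgroupOf N : Subgroup N) : Set N) := by
    have hset : ((V.subgroupOf N : Subgroup N) : Set N) = Subtype.val ⁻¹' ((Ut ⊔ W₀.toSubgroup : Subgroup D) : Set D) := by
      ext n
      simp only [SetLike.mem_coe, Subgroup.mem_subgroupOf, Set.mem_preimage, V, Subgroup.mem_inf]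
      exact ⟨fun h ↦ h.1, fun h ↦ ⟨h, n.2⟩⟩
    rw [hset]
    exact hsupo.preimage continuous_subtype_val
  haveI : DiscreteTopology (N ⧸ V.subgroupOf N) := QuotientGroup.discreteTopology hVo
  haveI : Finite (N ⧸ V.subgroupOf N) := finite_of_compact_of_discrete
  -- the class of `x` in `ker κ / V` has order `p`
  let xN : N := ⟨(x : D), hGκ x.2⟩
  have hxpV : xN ^ p ∈ V.subgroupOf N := by
    rw [Subgroup.mem_subgroupOf]
    change ((x : G) : D) ^ p ∈ V
    refine ⟨?_, N.pow_mem (hGκ x.2) p⟩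
    refine Subgroup.mem_sup_left (Subgroup.mem_sup_left ?_)
    exact Subgroup.mem_map.mpr ⟨x ^ p, hxpU, by simp⟩
  have hxV : xN ∉ V.subgroupOf N := by
    intro h
    rw [Subgroup.mem_subgroupOf] at h
    have h' : ((x : G) : D) ∈ ((Ut ⊔ W₀.toSubgroup : Subgroup D) : Set D) := h.1
    rw [hsupset] at h'
    exact hxUtW h'
  have horder : orderOf (QuotientGroup.mk xN : N ⧸ V.subgroupOf N) = p := by
    refine orderOf_eq_prime ?_ ?_
    · rw [← QuotientGroup.mk_pow, QuotientGroup.eq_one_iff]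
      exact hxpV
    · rw [Ne, QuotientGroup.eq_one_iff]
      exact hxV
  have hpdvd : p ∣ Nat.card (N ⧸ V.subgroupOf N) := horder ▸ orderOf_dvd_natCard _
  exact not_dvd_card_quotient_ker I hI φ hdense κ hκ hκφ V hIV hVN hVc hpdvd

end ProP

/-! ## §2. Number fields: (hp′_v) for a closed `H ≤ ker κ`, `κ` a `ℤ_p`-extension unramified and undecomposed at `v` -/

section NumberField

open NumberField IsDedekindDomain Field Literature.NumberTheory.EllipticCurves.GreenbergSelmer

variable {K : Type u} [Field K] [NumberField K] {p : ℕ} [Fact p.Prime]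

/-- `I_v ⊓ D_v`, viewed inside `D_v`, is a NORMAL subgroup (image of the normal `I_{K_v} ⊴ Γ_{K_v}` under `Γ_{K_v} ↠ D_v`).
[cite: NeukirchSchmidtWingberg2008, (7.5.3)] -/
theorem normal_inertia_subgroupOf_decomp (v : HeightOneSpectrum (𝓞 K)) :
    ((inertia v).subgroupOf (decomp (K := K) v)).Normal := by
  haveI : (absInertia (v.adicCompletion K)).Normal := absInertia_normal_holds (v.adicCompletion K)
  refine ⟨fun n hn g ↦ ?_⟩
  rw [Subgroup.mem_subgroupOf] at hn ⊢
  obtain ⟨τ, hτ, hτn⟩ := Subgroup.mem_map.mp hn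
  obtain ⟨σ, hσ⟩ := g.2
  rw [Subgroup.coe_mul, Subgroup.coe_mul, Subgroup.coe_inv, ← hτn, ← hσ]
  refine Subgroup.mem_map.mpr ⟨σ * τ * σ⁻¹, (inferInstance : (absInertia (v.adicCompletion K)).Normal).conj_mem τ hτ σ, ?_⟩
  simp only [map_mul, map_inv]

/-- `I_v ⊓ D_v` is closed in `D_v` (`I_{K_v}` is closed, hence compact, in `Γ_{K_v}`). [cite: NeukirchSchmidtWingberg2008, (7.5.3)] -/
theorem isClosed_inertia_subgroupOf_decomp (v : HeightOneSpectrum (𝓞 K)) :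
    IsClosed (((inertia v).subgroupOf (decomp (K := K) v) : Subgroup (decomp (K := K) v)) : Set (decomp (K := K) v)) := by
  haveI : CompactSpace (absoluteGaloisGroup (v.adicCompletion K)) := absoluteGaloisGroup_compactSpace _
  have hIc : IsClosed ((inertia v : Subgroup (absoluteGaloisGroup K)) : Set (absoluteGaloisGroup K)) := by
    change IsClosed (((absInertia (v.adicCompletion K)).map (absGaloisRestrict K (v.adicCompletion K)).toMonoidHom :
      Subgroup (absoluteGaloisGroup K)) : Set (absoluteGaloisGroup K))
    rw [Subgroup.coe_map]
    exact ((isClosed_absInertia_holds (v.adicCompletion K)).isCompact.image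
      (absGaloisRestrict K (v.adicCompletion K)).continuous).isClosed
  have hset : (((inertia v).subgroupOf (decomp (K := K) v) : Subgroup (decomp (K := K) v)) : Set (decomp (K := K) v)) =
      Subtype.val ⁻¹' ((inertia v : Subgroup (absoluteGaloisGroup K)) : Set (absoluteGaloisGroup K)) := by
    ext d; exact Subgroup.mem_subgroupOf
  rw [hset]
  exact hIc.preimage continuous_subtype_val

/-- **A Frobenius lift of `D_v` with `(I_v ⊓ D_v)·⟨φ⟩` dense in `D_v`** (transport of the tree's `dense_absInertia_mul_zpowers_of_isFrobPow`
along `Γ_{K_v} ↠ D_v`). [cite: NeukirchSchmidtWingberg2008, Thm. 7.5.3] -/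
theorem exists_dense_inertia_mul_zpowers_decomp (v : HeightOneSpectrum (𝓞 K)) :
    ∃ φ : decomp (K := K) v, Dense ((((inertia v).subgroupOf (decomp (K := K) v) : Subgroup (decomp (K := K) v)) :
      Set (decomp (K := K) v)) * (Subgroup.zpowers φ : Set (decomp (K := K) v))) := by
  obtain ⟨Fr, hFr⟩ := exists_isFrobPow_holds (v.adicCompletion K) 1
  let r := (absGaloisRestrict K (v.adicCompletion K)).toMonoidHom
  let rD : absoluteGaloisGroup (v.adicCompletion K) →* decomp (K := K) v := r.rangeRestrict
  have hrDc : Continuous rD := (absGaloisRestrict K (v.adicCompletion K)).continuous.subtype_mk _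
  have hrDs : Function.Surjective rD := MonoidHom.rangeRestrict_surjective r
  refine ⟨rD Fr, ?_⟩
  have hdense := dense_absInertia_mul_zpowers_of_isFrobPow (F := v.adicCompletion K) hFr
  have himg : rD '' ((absInertia (v.adicCompletion K) : Set _) * (Subgroup.zpowers Fr : Set _)) =
      (((inertia v).subgroupOf (decomp (K := K) v) : Subgroup (decomp (K := K) v)) : Set (decomp (K := K) v)) *
        (Subgroup.zpowers (rD Fr) : Set (decomp (K := K) v)) := by
    rw [Set.image_mul, ← Subgroup.coe_map, ← Subgroup.coe_map, MonoidHom.map_zpowers]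
    congr 1
    ext d
    simp only [SetLike.mem_coe, Subgroup.mem_map, Subgroup.mem_subgroupOf]
    constructor
    · rintro ⟨τ, hτ, rfl⟩
      exact Subgroup.mem_map.mpr ⟨τ, hτ, rfl⟩
    · intro hd
      obtain ⟨τ, hτ, hτd⟩ := Subgroup.mem_map.mp hd
      exact ⟨τ, hτ, Subtype.ext hτd⟩
  rw [← himg]
  exact hrDs.denseRange.dense_image hrDc hdense

/-- **(hp′_v) from a `ℤ_p`-extension unramified and undecomposed at `v`.** Let `κ : ZpExtension K p` satisfy (U) `I_v ≤ ker κ` and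
(N) `∃ τ ∈ D_v, κ τ ≠ 1`, and let `H ≤ ker κ` be closed. Then every open subgroup of `H ⊓ D_v` containing `H ⊓ I_v` has index prime to
`p` — the hypothesis (hp′_v) of part IV's `greenbergKer_eq_strictKer_of_coprime` / `unrEverywhere₂_eq_datumStrictSelmer_of_coprime`,
VERBATIM. For the `ℤ_p²`-tower take `H = pairKer κ₁ κ₂ ≤ ker κ₂` with `κ₂` unramified outside `v̄` (so (U) at `v ≠ v̄`); (N) at a split
prime of an imaginary quadratic field is the tree's `LinePin.exists_mem_decomp_vbar_apply_eq_of_discr` (DA7 frame).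
[cite: NeukirchSchmidtWingberg2008, (7.1.8) (i)] [cite: deShalit1987, II.1.9] -/
theorem coprime_card_quotient_decompIn_of_zpExtension (κ : ZpExtension K p) {v : HeightOneSpectrum (𝓞 K)}
    (hU : inertia v ≤ κ.kerSubgroup) (hN : ∃ τ ∈ decomp v, κ τ ≠ 1)
    (H : Subgroup (absoluteGaloisGroup K)) (hH : IsClosed (H : Set (absoluteGaloisGroup K))) (hHκ : H ≤ κ.kerSubgroup) :
    ∀ U : Subgroup (decompIn H v), IsOpen (U : Set (decompIn H v)) →
      (inertiaIn H v).subgroupOf (decompIn H v) ≤ U → (Nat.card (decompIn H v ⧸ U)).Coprime p := by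
  intro U hUo hIU
  haveI : CompactSpace (decomp (K := K) v) := by
    haveI : CompactSpace (absoluteGaloisGroup (v.adicCompletion K)) := absoluteGaloisGroup_compactSpace _
    refine isCompact_iff_compactSpace.mp ?_
    change IsCompact ((absGaloisRestrict K (v.adicCompletion K)).toMonoidHom.range : Set (absoluteGaloisGroup K))
    rw [MonoidHom.coe_range]
    exact isCompact_range (absGaloisRestrict K (v.adicCompletion K)).continuous
  haveI := normal_inertia_subgroupOf_decomp (K := K) v
  obtain ⟨φ, hdense⟩ := exists_dense_inertia_mul_zpowers_decomp (K := K) v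
  -- `κ` on `D_v`
  let κD : decomp (K := K) v →* Multiplicative ℤ_[p] := κ.toContinuousMonoidHom.toMonoidHom.comp (decomp (K := K) v).subtype
  have hκDc : Continuous κD := κ.toContinuousMonoidHom.continuous.comp continuous_subtype_val
  have hκDI : (inertia v).subgroupOf (decomp (K := K) v) ≤ κD.ker := fun d hd ↦ by
    rw [MonoidHom.mem_ker]
    exact ZpExtension.mem_kerSubgroup.mp (hU (Subgroup.mem_subgroupOf.mp hd))
  -- (N) ⟹ `κ φ ≠ 1` (else `κ` kills the dense `I·⟨φ⟩`, hence `D_v`)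
  have hκφ : κD φ ≠ 1 := by
    intro hφ
    obtain ⟨τ, hτ, hκτ⟩ := hN
    apply hκτ
    have hker : IsClosed ((κD.ker : Subgroup (decomp (K := K) v)) : Set (decomp (K := K) v)) := by
      rw [MonoidHom.coe_ker]
      exact isClosed_singleton.preimage hκDc
    have hsub : ((((inertia v).subgroupOf (decomp (K := K) v) : Subgroup (decomp (K := K) v)) : Set (decomp (K := K) v)) *
        (Subgroup.zpowers φ : Set (decomp (K := K) v))) ⊆ (κD.ker : Set (decomp (K := K) v)) := by
      rintro _ ⟨i, hi, z, hz, rfl⟩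
      exact κD.ker.mul_mem (hκDI hi) ((Subgroup.zpowers_le.mpr (by rwa [MonoidHom.mem_ker])) hz)
    have hall : (κD.ker : Set (decomp (K := K) v)) = Set.univ := by
      refine Set.eq_univ_of_univ_subset ?_
      rw [← hdense.closure_eq]
      exact hker.closure_subset_iff.mpr hsub
    have hτker : (⟨τ, hτ⟩ : decomp (K := K) v) ∈ (κD.ker : Set (decomp (K := K) v)) := by rw [hall]; exact Set.mem_univ _
    exact MonoidHom.mem_ker.mp hτker
  -- `G = H ⊓ D_v` is closed and inside `ker κ`
  have hGc : IsClosed ((decompIn H v : Subgroup (decomp (K := K) v)) : Set (decomp (K := K) v)) := by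
    have hset : ((decompIn H v : Subgroup (decomp (K := K) v)) : Set (decomp (K := K) v)) =
        Subtype.val ⁻¹' (H : Set (absoluteGaloisGroup K)) := by
      ext x; exact mem_decompIn_iff H v x
    rw [hset]
    exact hH.preimage continuous_subtype_val
  have hGκ : decompIn H v ≤ κD.ker := fun g hg ↦ by
    rw [MonoidHom.mem_ker]
    exact ZpExtension.mem_kerSubgroup.mp (hHκ ((mem_decompIn_iff H v g).mp hg))
  refine coprime_card_quotient_of_le_ker ((inertia v).subgroupOf (decomp (K := K) v)) (isClosed_inertia_subgroupOf_decomp v)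
    φ hdense κD hκDc hκDI hκφ (decompIn H v) hGc hGκ U hUo fun g hg ↦ hIU ?_
  rw [Subgroup.mem_subgroupOf] at hg ⊢
  exact (mem_inertiaIn_iff H v g).mpr ⟨(mem_decompIn_iff H v g).mp g.2, Subgroup.mem_subgroupOf.mp hg⟩

end NumberField

end Summit.BirchSwinnertonDyer.BirchSwinnertonDyer.Theorems.PrintCf2.JLKDescent

end
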